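import Mathlib.Analysis.SpecialFunctions.Complex.Log
import Mathlib.Analysis.SpecialFunctions.Complex.Arg
import Mathlib.Analysis.Real.Pi.Bounds
import Mathlib.RingTheory.Valuation.ValuationSubring
import Mathlib.NumberTheory.NumberField.Units.DirichletTheorem
import Mathlib.GroupTheory.OrderOfElement
import Mathlib.Algebra.Group.TypeTags.Basic
import Mathlib.Algebra.Ring.Parity
import Mathlib.Tactic.Linarith
import Mathlib.Tactic.FieldSimp
import HarnessLib

/-!
# [IUTchIII] §1: the local log-shells at the concrete level (Def 1.1 (i)(ii), Remarks 1.1.1 (ii), 1.2.2 (i)(ii), 1.2.3 (i)(ii))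

Mochizuki, *Inter-universal Teichmüller Theory III*, kurims manuscript (May 2020), §1
[cite: Mochizuki2012, III Def 1.1 (i)(ii) pp.23–26; Rmk 1.2.2 (i)(ii) p.36; Rmk 1.2.3 (i)(ii) p.39]
(D-0012 claim key, status disputed; the items typed here are classical local/number-field facts
that the text RECALLS — "at a more concrete level" — and this file takes no side on anything).

Printed text. Remark 1.2.2 (p. 36), with `†F` the `F`-prime-strip of [IUTchI] Examples 3.2–3.4:

* (i) `v ∈ V̲^non`, `k := K_v` an MLF, `O_k`, `O_k^×`, `log_k : O_k^× → k` the `p_v`-adic logarithm.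
  "the log-shell "`I_{†F_v}`" corresponds to the submodule `I_k := (p_v^*)⁻¹ · log_k(O_k^×) ⊆ k` — where
  `p_v^* = p_v` if `p_v` is odd, `p_v^* = p_v²` if `p_v` is even [Def 1.1 (i) p.24] — while the
  properties (b^non), (c^non) of Proposition 1.2, (v), correspond, respectively, to the evident
  inclusions `O_k^▷ := O_k \ {0} ⊆ O_k ⊆ I_k`; `log_k(O_k^×) ⊆ I_k` of subsets of `k`."
* (ii) `v ∈ V̲^arc`, `k := K_v` a complex archimedean field, `O_k = {|a| ≤ 1}`, `O_k^× = {|a| = 1}`,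
  `exp_k : k → k^×`. "the log-shell "`I_{†F_v}`" corresponds to the subset `I_k := {a ∈ k | |a| ≤ π}`
  … while the properties (b^arc), (c^arc) … correspond, respectively, to the evident inclusions
  `O_k^▷ := O_k \ {0} ⊆ O_k ⊆ I_k`; `O_k^× ⊆ exp_k(I_k)`."
* Def 1.1 (ii) p.26 (archimedean log-shell, intrinsic description): "the `Ψ^×`-orbit of the
  [uniquely determined] closed line segment of `Ψ^∼` which is preserved by multiplication by `±1` and
  whose endpoints differ by a generator of the kernel of the natural surjection `Ψ^∼ ↠ Ψ^{gp}`"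
  [the universal covering `exp : ℂ ↠ ℂ^×`].
* Rmk 1.2.3 (i) p.39: a multiplicative indeterminacy by `H ⊆ O_k^×` becomes the additive
  indeterminacy by `log_k(H)`; "if `H` consists of roots of unity, then `log_k(H) = {0}`, so the
  resulting additive indeterminacy ceases to exist."
* Rmk 1.2.3 (ii) p.39: for `f ∈ F_mod^×`, being a unit at all `v ∈ V̲` "corresponds precisely [cf.
  [Lang], p. 144, the proof of Theorem 5] to the case where `f` is a root of unity";
  Rmk 1.1.1 (ii) p.29: "the well-known discreteness of the image of the units of a number field via
  the logarithms of the various archimedean valuations [cf. [Lang], p. 144, Theorem 5]".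

What is typed and proved. `pStar` (Def 1.1 (i)); the nonarchimedean model over an ABSTRACT
logarithm `logk : Additive O_kˣ →+ k` on the units of a valuation subring (the `p_v`-adic logarithm
itself, with its image sandwich, is campaign-S infrastructure — TODO-merge: abc-iut-S1; the one
analytic input, `O_k ⊆ I_k`, is therefore the predicate `IntegersSubsetLogShell`, not a theorem);
PROVED: (c^non) `log_mem_nonarchLogShell` for any such hom, Rmk 1.2.3 (i) `log_eq_zero_of_pow_eq_one` /
`log_eq_zero_of_isOfFinOrder` (char 0). The archimedean model with `k = ℂ`; PROVED: (b^arc), (c^arc)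
(`arcUnits_subset_exp_arcLogShell`), and Def 1.1 (ii)'s intrinsic description
`arcLogShell_eq_orbit_segment` (`{|a| ≤ π}` = `S¹ · [−πi, πi]`, the segment being `±1`-stable with
endpoints differing by the generator `2πi` of `ker exp`). Rmk 1.2.3 (ii) and Rmk 1.1.1 (ii) are
Mathlib's `NumberField.Units.mem_torsion` and `instDiscrete_unitLattice`, re-cited. NOT here: the
ind-topological / Galois-equivariant packaging of Def 1.1 (the monoids `Ψ_{†F_v}`, `G_v(†Π_v)`-actions,
Frobenioids) — interface level, files `LogLink.lean` ff. of this directory; Rmk 1.2.1 (ii) (metrics on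
a complex archimedean field form an `ℝ_{>0}`-torsor) — not needed downstream, deferred.
-/

namespace Literature.IUT.LogThetaLattice

open Complex Real

/-! ### Def 1.1 (i): the normalising factor `p_v^*` -/

/-- `p^* := p` when `p` is odd and `p^* := p²` when `p` is even [cite: Mochizuki2012, III Def 1.1 (i) p.24]
(so `2^* = 4`; the log-shell is `(p^*)⁻¹` times the pre-log-shell `log_k(O_k^×)`). -/
def pStar (p : ℕ) : ℕ := if Even p then p ^ 2 else p

/-- `2^* = 4`. [cite: Mochizuki2012, III Def 1.1 (i) p.24] -/
theorem pStar_two : pStar 2 = 4 := by decide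

/-- For odd `p`, `p^* = p`. [cite: Mochizuki2012, III Def 1.1 (i) p.24] -/
theorem pStar_of_odd {p : ℕ} (hp : Odd p) : pStar p = p := by
  simp [pStar, Nat.not_even_iff_odd.mpr hp]

/-- For even `p`, `p^* = p²`. [cite: Mochizuki2012, III Def 1.1 (i) p.24] -/
theorem pStar_of_even {p : ℕ} (hp : Even p) : pStar p = p ^ 2 := by
  simp [pStar, hp]

/-- `p ∣ p^*`. [cite: Mochizuki2012, III Def 1.1 (i) p.24] -/
theorem dvd_pStar (p : ℕ) : p ∣ pStar p := by
  unfold pStar; split_ifs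
  · exact Dvd.intro_left (p.pow 1) rfl
  · exact dvd_rfl

/-- `p^* ≠ 0` for `p ≠ 0`. [cite: Mochizuki2012, III Def 1.1 (i) p.24] -/
theorem pStar_ne_zero {p : ℕ} (hp : p ≠ 0) : pStar p ≠ 0 := by
  unfold pStar; split_ifs
  · exact pow_ne_zero 2 hp
  · exact hp

/-! ### Rmk 1.2.2 (i): the nonarchimedean model `I_k = (p^*)⁻¹ · log_k(O_k^×)` -/

section Nonarchimedean

variable {k : Type*} [Field k] (O : ValuationSubring k) (logk : Additive (↥O)ˣ →+ k) (p : ℕ)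

/-- `O_k^▷ := O_k \ {0}`, the multiplicative monoid of nonzero integers, as a subset of `k`.
[cite: Mochizuki2012, III Rmk 1.2.2 (i) p.36] -/
def nonzeroIntegers : Set k := {a | a ∈ O ∧ a ≠ 0}

/-- The image `log_k(O_k^×) ⊆ k` of the units under the logarithm (the "pre-log-shell" of Def 1.1 (i),
up to the Galois-invariants packaging). Here `logk` is an abstract homomorphism `O_k^× → (k, +)`;
the `p_v`-adic logarithm is the intended instance (TODO-merge: abc-iut-S1).
[cite: Mochizuki2012, III Def 1.1 (i) p.24] -/
def logUnits : Set k := Set.range fun x : (↥O)ˣ => logk (Additive.ofMul x)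

/-- The log-shell `I_k := (p^*)⁻¹ · log_k(O_k^×) ⊆ k`. [cite: Mochizuki2012, III Rmk 1.2.2 (i) p.36] -/
def nonarchLogShell : Set k := {a | ∃ x : (↥O)ˣ, a = ((pStar p : ℕ) : k)⁻¹ * logk (Additive.ofMul x)}

/-- First inclusion of (b^non): `O_k^▷ ⊆ O_k`. [cite: Mochizuki2012, III Rmk 1.2.2 (i) p.36] -/
theorem nonzeroIntegers_subset : nonzeroIntegers O ⊆ (O : Set k) := fun _ ha => ha.1

/-- Second inclusion of (b^non): `O_k ⊆ I_k`, i.e. `p^* · O_k ⊆ log_k(O_k^×)` — for the `p`-adic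
logarithm of an MLF of residue characteristic `p` this is the bijectivity of `log : 1 + p^* O_k ⥲ p^* O_k`
([AbsTopIII] Def 5.4 (iii); [IUTchIV] Prop 1.2 (i)). Recorded as a PREDICATE on the abstract datum
`logk` (the analytic proof belongs to the `p`-adic-log file of campaign S; TODO-merge: abc-iut-S1).
[cite: Mochizuki2012, III Rmk 1.2.2 (i) p.36] -/
@[mk_iff] structure IntegersSubsetLogShell : Prop where
  /-- `O_k ⊆ I_k = (p^*)⁻¹ · log_k(O_k^×)` -/
  subset : (O : Set k) ⊆ nonarchLogShell O logk p

/-- (b^non) assembled: under `IntegersSubsetLogShell`, `O_k^▷ ⊆ O_k ⊆ I_k`. [cite: Mochizuki2012, III Rmk 1.2.2 (i) p.36] -/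
theorem nonzeroIntegers_subset_logShell (h : IntegersSubsetLogShell O logk p) :
    nonzeroIntegers O ⊆ nonarchLogShell O logk p :=
  (nonzeroIntegers_subset O).trans h.subset

/-- **(c^non): `log_k(O_k^×) ⊆ I_k`** — PROVED for any homomorphism `logk : O_k^× → (k,+)` as soon as
`p^* ≠ 0` in `k`: `log_k(x) = (p^*)⁻¹ · log_k(x^{p^*})`. [cite: Mochizuki2012, III Rmk 1.2.2 (i) p.36] -/
theorem log_mem_nonarchLogShell (hp : ((pStar p : ℕ) : k) ≠ 0) (x : (↥O)ˣ) :
    logk (Additive.ofMul x) ∈ nonarchLogShell O logk p := by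
  refine ⟨x ^ pStar p, ?_⟩
  rw [ofMul_pow, map_nsmul, nsmul_eq_mul, ← mul_assoc, inv_mul_cancel₀ hp, one_mul]

/-- (c^non) as an inclusion of sets: `log_k(O_k^×) ⊆ I_k`. [cite: Mochizuki2012, III Rmk 1.2.2 (i) p.36] -/
theorem logUnits_subset_nonarchLogShell (hp : ((pStar p : ℕ) : k) ≠ 0) :
    logUnits O logk ⊆ nonarchLogShell O logk p := by
  rintro _ ⟨x, rfl⟩
  exact log_mem_nonarchLogShell O logk p hp x

/-- **Rmk 1.2.3 (i): roots of unity have logarithm `0`** (in characteristic `0`): if `x^n = 1` with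
`n ≥ 1` then `n · log_k(x) = 0`, so `log_k(x) = 0`. [cite: Mochizuki2012, III Rmk 1.2.3 (i) p.39] -/
theorem log_eq_zero_of_pow_eq_one [CharZero k] (x : (↥O)ˣ) {n : ℕ} (hn : n ≠ 0) (hx : x ^ n = 1) :
    logk (Additive.ofMul x) = 0 := by
  have h : (n : k) * logk (Additive.ofMul x) = 0 := by
    rw [← nsmul_eq_mul, ← map_nsmul, ← ofMul_pow, hx, ofMul_one, map_zero]
  rcases mul_eq_zero.mp h with h | h
  · exact absurd (by exact_mod_cast h) hn
  · exact h

/-- Rmk 1.2.3 (i), torsion form: every element of finite order of `O_k^×` has logarithm `0`; hence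
"if `H` consists of roots of unity, then `log_k(H) = {0}`, so the resulting additive indeterminacy
ceases to exist". [cite: Mochizuki2012, III Rmk 1.2.3 (i) p.39] -/
theorem log_eq_zero_of_isOfFinOrder [CharZero k] (x : (↥O)ˣ) (hx : IsOfFinOrder x) :
    logk (Additive.ofMul x) = 0 :=
  log_eq_zero_of_pow_eq_one O logk x (orderOf_pos_iff.mpr hx).ne' (pow_orderOf_eq_one x)

/-- Rmk 1.2.3 (i) for a subgroup `H ⊆ O_k^×` of roots of unity: `log_k(H) = {0}`.
[cite: Mochizuki2012, III Rmk 1.2.3 (i) p.39] -/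
theorem log_image_torsion_subgroup [CharZero k] (H : Subgroup (↥O)ˣ) (hH : ∀ x ∈ H, IsOfFinOrder x) :
    (fun x : (↥O)ˣ => logk (Additive.ofMul x)) '' (H : Set (↥O)ˣ) = {0} := by
  apply Set.eq_singleton_iff_unique_mem.mpr
  refine ⟨⟨1, H.one_mem, by simp⟩, ?_⟩
  rintro _ ⟨x, hx, rfl⟩
  exact log_eq_zero_of_isOfFinOrder O logk x (hH x hx)

end Nonarchimedean

/-! ### Rmk 1.2.2 (ii) and Def 1.1 (ii): the archimedean model in `k = ℂ` -/

/-- `O_k := {a ∈ k | |a| ≤ 1}` for the complex archimedean field `k = ℂ`. [cite: Mochizuki2012, III Rmk 1.2.2 (ii) p.36] -/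
def arcIntegers : Set ℂ := {a | ‖a‖ ≤ 1}

/-- `O_k^× := {a ∈ k | |a| = 1}` (the unit circle `S¹`). [cite: Mochizuki2012, III Rmk 1.2.2 (ii) p.36] -/
def arcUnits : Set ℂ := {a | ‖a‖ = 1}

/-- `O_k^▷ := O_k \ {0}`. [cite: Mochizuki2012, III Rmk 1.2.2 (ii) p.36] -/
def arcNonzeroIntegers : Set ℂ := arcIntegers \ {0}

/-- The archimedean log-shell `I_k := {a ∈ k | |a| ≤ π}`. [cite: Mochizuki2012, III Rmk 1.2.2 (ii) p.36] -/
def arcLogShell : Set ℂ := {a | ‖a‖ ≤ π}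

/-- First inclusion of (b^arc): `O_k^▷ ⊆ O_k`. [cite: Mochizuki2012, III Rmk 1.2.2 (ii) p.36] -/
theorem arcNonzeroIntegers_subset : arcNonzeroIntegers ⊆ arcIntegers := Set.sdiff_subset

/-- **Second inclusion of (b^arc): `O_k ⊆ I_k`** (as `1 ≤ π`). [cite: Mochizuki2012, III Rmk 1.2.2 (ii) p.36] -/
theorem arcIntegers_subset_arcLogShell : arcIntegers ⊆ arcLogShell := fun a (ha : ‖a‖ ≤ 1) =>
  show ‖a‖ ≤ π from ha.trans (by linarith [Real.pi_gt_three])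

/-- The units lie in `O_k`. [cite: Mochizuki2012, III Rmk 1.2.2 (ii) p.36] -/
theorem arcUnits_subset_arcIntegers : arcUnits ⊆ arcIntegers := fun _ (ha : ‖_‖ = 1) => ha.le

/-- **(c^arc): `O_k^× ⊆ exp_k(I_k)`** — every `a` with `|a| = 1` is `exp(i·arg a)` with `|arg a| ≤ π`.
[cite: Mochizuki2012, III Rmk 1.2.2 (ii) p.36] -/
theorem arcUnits_subset_exp_arcLogShell : arcUnits ⊆ Complex.exp '' arcLogShell := by
  intro a (ha : ‖a‖ = 1)
  have ha0 : a ≠ 0 := fun h => by simp [h] at ha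
  refine ⟨Complex.log a, ?_, Complex.exp_log ha0⟩
  show ‖Complex.log a‖ ≤ π
  have hre : (Complex.log a).re = 0 := by rw [Complex.log_re, ha, Real.log_one]
  calc ‖Complex.log a‖ ≤ |(Complex.log a).re| + |(Complex.log a).im| := Complex.norm_le_abs_re_add_abs_im _
    _ = |Complex.arg a| := by rw [hre, abs_zero, zero_add, Complex.log_im]
    _ ≤ π := Complex.abs_arg_le_pi a

/-- The closed line segment `[−πi, πi] ⊆ ℂ = Ψ^∼` of Def 1.1 (ii): `{t·πi | t ∈ [−1, 1]}`.
[cite: Mochizuki2012, III Def 1.1 (ii) p.26] -/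
def fundamentalSegment : Set ℂ := {z | ∃ t : ℝ, t ∈ Set.Icc (-1 : ℝ) 1 ∧ z = ((t * π : ℝ) : ℂ) * I}

/-- The segment is "preserved by multiplication by `±1`". [cite: Mochizuki2012, III Def 1.1 (ii) p.26] -/
theorem neg_mem_fundamentalSegment {z : ℂ} (hz : z ∈ fundamentalSegment) : -z ∈ fundamentalSegment := by
  obtain ⟨t, ⟨ht1, ht2⟩, rfl⟩ := hz
  refine ⟨-t, ⟨by linarith, by linarith⟩, ?_⟩
  push_cast; ring

/-- Its endpoints `±πi` "differ by a generator of the kernel of the natural surjection `Ψ^∼ ↠ Ψ^{gp}`",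
i.e. of `exp : ℂ → ℂ^×`: `πi − (−πi) = 2πi` and `exp z = 1 ↔ z ∈ ℤ · 2πi`.
[cite: Mochizuki2012, III Def 1.1 (ii) p.26] -/
theorem fundamentalSegment_endpoints :
    ((π : ℝ) : ℂ) * I - (-(((π : ℝ) : ℂ) * I)) = 2 * π * I ∧
      ∀ z : ℂ, Complex.exp z = 1 ↔ ∃ n : ℤ, z = n * (2 * π * I) :=
  ⟨by ring, fun z => Complex.exp_eq_one_iff⟩

/-- Every point of the segment has absolute value `≤ π`. [cite: Mochizuki2012, III Def 1.1 (ii) p.26] -/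
theorem norm_le_pi_of_mem_fundamentalSegment {z : ℂ} (hz : z ∈ fundamentalSegment) : ‖z‖ ≤ π := by
  obtain ⟨t, ⟨ht1, ht2⟩, rfl⟩ := hz
  rw [norm_mul, Complex.norm_I, mul_one, Complex.norm_real, Real.norm_eq_abs, abs_mul,
    abs_of_pos Real.pi_pos]
  calc |t| * π ≤ 1 * π := by gcongr; exact abs_le.mpr ⟨ht1, ht2⟩
    _ = π := one_mul π

/-- **Def 1.1 (ii) ⇔ Rmk 1.2.2 (ii): the archimedean log-shell `{|a| ≤ π}` IS "the `Ψ^×`-orbit of the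
closed line segment" `[−πi, πi]`, i.e. `I_k = O_k^× · [−πi, πi]`.**
[cite: Mochizuki2012, III Def 1.1 (ii) p.26] -/
theorem arcLogShell_eq_orbit_segment :
    arcLogShell = {z | ∃ u ∈ arcUnits, ∃ s ∈ fundamentalSegment, z = u * s} := by
  ext z
  constructor
  · intro (hz : ‖z‖ ≤ π)
    by_cases h0 : z = 0
    · refine ⟨1, by simp [arcUnits], 0, ⟨0, by simp, by simp⟩, by simp [h0]⟩
    · have hzn : (‖z‖ : ℂ) ≠ 0 := by exact_mod_cast norm_ne_zero_iff.mpr h0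
      have hpi : (π : ℂ) ≠ 0 := by exact_mod_cast Real.pi_ne_zero
      refine ⟨z / ((‖z‖ : ℂ) * I), ?_, ((‖z‖ / π * π : ℝ) : ℂ) * I,
        ⟨‖z‖ / π, ⟨by have := norm_nonneg z; have := Real.pi_pos; linarith [div_nonneg (norm_nonneg z) Real.pi_pos.le],
          (div_le_one Real.pi_pos).mpr hz⟩, rfl⟩, ?_⟩
      · show ‖z / ((‖z‖ : ℂ) * I)‖ = 1
        rw [norm_div, norm_mul, Complex.norm_I, mul_one, Complex.norm_real, Real.norm_eq_abs,
          abs_of_nonneg (norm_nonneg z), div_self (norm_ne_zero_iff.mpr h0)]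
      · rw [div_mul_cancel₀ _ Real.pi_ne_zero]
        field_simp
  · rintro ⟨u, hu, s, hs, rfl⟩
    show ‖u * s‖ ≤ π
    rw [norm_mul, show ‖u‖ = 1 from hu, one_mul]
    exact norm_le_pi_of_mem_fundamentalSegment hs

/-- Hence `O_k^× · I_k = I_k`: the log-shell is stable under the units (it is an orbit).
[cite: Mochizuki2012, III Def 1.1 (ii) p.26] -/
theorem unit_mul_mem_arcLogShell {u z : ℂ} (hu : u ∈ arcUnits) (hz : z ∈ arcLogShell) : u * z ∈ arcLogShell := by
  show ‖u * z‖ ≤ π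
  rw [norm_mul, show ‖u‖ = 1 from hu, one_mul]; exact hz

/-! ### Rmk 1.2.3 (ii) and Rmk 1.1.1 (ii): two facts about units of number fields ([Lang] p. 144) -/

/-- **Rmk 1.2.3 (ii)**: for a unit `f` of the ring of integers of a number field `F` (i.e. `f` a unit at
every nonarchimedean place), `f` is a unit at all `v ∈ V̲` — `|f|_w = 1` at every archimedean place `w`
too — "precisely [in] the case where `f` is a root of unity" [cf. [Lang], p. 144, proof of Thm 5].
This is Mathlib's `NumberField.Units.mem_torsion`. [cite: Mochizuki2012, III Rmk 1.2.3 (ii) p.39] -/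
theorem unit_at_all_places_iff_torsion (F : Type*) [Field F] [NumberField F] (f : (NumberField.RingOfIntegers F)ˣ) :
    (∀ w : NumberField.InfinitePlace F, w f = 1) ↔ f ∈ NumberField.Units.torsion F :=
  (NumberField.Units.mem_torsion (K := F)).symm

/-- **Rmk 1.1.1 (ii)**: "the well-known discreteness of the image of the units of a number field via
the logarithms of the various archimedean valuations of the number field [cf., e.g., [Lang], p. 144,
Theorem 5]" — Mathlib's Dirichlet unit theorem file: the unit lattice (image of the logarithmic
embedding) carries the discrete topology. [cite: Mochizuki2012, III Rmk 1.1.1 (ii) p.29] -/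
theorem discreteTopology_unitLattice (F : Type*) [Field F] [NumberField F] :
    DiscreteTopology (NumberField.Units.unitLattice F) :=
  inferInstance

end Literature.IUT.LogThetaLattice
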